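import Literature.Algebra.Polynomial.CasasAlvero.Trinomial
import HarnessLib

/-!
# Bad digits in characteristic 17: sparse Casas-Alvero polynomials for the digits `12, 14, 15`

Explicit `𝔽_17`-rational centred trinomials with `𝔽_17`-rational witnesses refuting `CA_a` over EVERY field of
characteristic `17` for each listed digit `a` (criterion `not_holdsInDegree_of_trinomial`); the other digits
`7 ≤ a ≤ 16` are refuted by the degree-`7` bad-prime table, the binomial criterion and `BadPrime17.lean` (see the classification
file that imports this one), while the digit `6` is a Casas-Alvero digit: `17` is a good prime for degree `6`
([CastryckLaterveerOunaies2012, Thm. 4]; formal proof in `Degree6.lean`).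
Examples found by exhaustive search (`cls/sparse_search.py`, seat-2 g5 packet), each double-checked by the independent `cls/check2.py`;
each proof is a handful of integer congruences modulo `17`. [folklore]
-/

noncomputable section

open Polynomial

namespace Literature.Algebra.Polynomial.CasasAlvero

section Char17

variable (K : Type*) [Field K]

/-- `X^12 - 2X^4 + X` refutes `CA_12` in characteristic `17` (`H_4`-witness `1`, `H_1`-witness `5`). [folklore] -/
theorem not_holdsInDegree_twelve_of_char_17 [CharP K 17] : ¬ HoldsInDegree K 12 := by
  have hp : (17 : K) = 0 := by simpa using CharP.cast_eq_zero K 17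
  refine not_holdsInDegree_of_trinomial (d := 12) (m := 4) (n := 1) (by norm_num) (by norm_num) (by norm_num)
    (s := -2) (t := 1) ?_ 1 5 ?_ ?_ ?_ ?_
  · intro h
    have h' : ((1 : ℕ) : K) = 0 := by exact_mod_cast h
    rw [CharP.cast_eq_zero_iff K 17] at h'
    norm_num at h'
  · linear_combination (0 : K) * hp
  · simp only [show Nat.choose 12 4 = 495 from rfl]
    push_cast
    linear_combination (29 : K) * hp
  · linear_combination (14361140 : K) * hp
  · simp only [show Nat.choose 12 1 = 12 from rfl, show Nat.choose 4 1 = 4 from rfl]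
    push_cast
    linear_combination (34466853 : K) * hp

/-- `X^14 - 3X^12 + X^3` refutes `CA_14` in characteristic `17` (`H_12`-witness `3`, `H_3`-witness `13`). [folklore] -/
theorem not_holdsInDegree_fourteen_of_char_17 [CharP K 17] : ¬ HoldsInDegree K 14 := by
  have hp : (17 : K) = 0 := by simpa using CharP.cast_eq_zero K 17
  refine not_holdsInDegree_of_trinomial (d := 14) (m := 12) (n := 3) (by norm_num) (by norm_num) (by norm_num)
    (s := -3) (t := 1) ?_ 3 13 ?_ ?_ ?_ ?_
  · intro h
    have h' : ((1 : ℕ) : K) = 0 := by exact_mod_cast h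
    rw [CharP.cast_eq_zero_iff K 17] at h'
    norm_num at h'
  · linear_combination (187569 : K) * hp
  · simp only [show Nat.choose 14 12 = 91 from rfl]
    push_cast
    linear_combination (48 : K) * hp
  · linear_combination (227498948843179 : K) * hp
  · simp only [show Nat.choose 14 3 = 364 from rfl, show Nat.choose 12 3 = 220 from rfl]
    push_cast
    linear_combination (37961612579017 : K) * hp

/-- `X^15 + 8X^6 + 3X` refutes `CA_15` in characteristic `17` (`H_6`-witness `6`, `H_1`-witness `2`). [folklore] -/
theorem not_holdsInDegree_fifteen_of_char_17 [CharP K 17] : ¬ HoldsInDegree K 15 := by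
  have hp : (17 : K) = 0 := by simpa using CharP.cast_eq_zero K 17
  refine not_holdsInDegree_of_trinomial (d := 15) (m := 6) (n := 1) (by norm_num) (by norm_num) (by norm_num)
    (s := 8) (t := 3) ?_ 6 2 ?_ ?_ ?_ ?_
  · intro h
    have h' : ((3 : ℕ) : K) = 0 := by exact_mod_cast h
    rw [CharP.cast_eq_zero_iff K 17] at h'
    norm_num at h'
  · linear_combination (27657962226 : K) * hp
  · simp only [show Nat.choose 15 6 = 5005 from rfl]
    push_cast
    linear_combination (2966992264 : K) * hp
  · linear_combination (1958 : K) * hp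
  · simp only [show Nat.choose 15 1 = 15 from rfl, show Nat.choose 6 1 = 6 from rfl]
    push_cast
    linear_combination (14547 : K) * hp

end Char17

end Literature.Algebra.Polynomial.CasasAlvero
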